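import Summits.KontsevichZagierPeriods.Zeta5Search.Denom.TwoTaleP15WindowWeights

/-!
# The window of the second tale at P15's partner, II: the gap sum `Σ_j B_j κ_j` is `p`-integral

HONEST FRAMING: systematic search; no irrationality claim unless certified.  Cell `pub-zeta5`,
DENOMINATOR ARITHMETIC lane, THEOREM W of `families/denom/P15KERNEL.md` §10.9, step (G).  Pure
`p`-adic bookkeeping; nothing about irrationality.

For `n ≥ 1` and an odd prime `p = 2h+1` with `13n < p ≤ 17n` put `c₀ = 26n + 2 − p`.  For `j ∈ I_B`:
* (reflection) `H(26n+1−j) ≡ H(j − c₀) (mod p)` (`WindowHarmonic.HI_reflect_modP`), hence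
  `κ_j ≡ H(j − 13n − 1) − H(j − c₀) = −Σ_{c=c₀}^{13n} 1/(j − c)` — a sum over the GAP of integer
  NON-poles `c ∈ [c₀, 13n]` of `R̂` (`kap_modP`);
* (polar identity at a non-pole) by the tree's `RT_eq_polar` at `t = −c`:
  `Σ_{j∈I_B} B_j/(j − c) = R̂(−c) − Σ_{j∈I_A} A_j/(j − c)²`, where `R̂(−c) = 0` because `2c` lies in
  the doubled zero block `[15n+2, 32n+1]` (`RT_neg_int_eq_zero`), and the `A`-part is `p`-integral
  (`A_j ∈ ℤ_p`, `0 < j − c < p`);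
* hence, exchanging weights under `Σ_j B_j ·` (`‖B_j‖_p ≤ p`, key lemma of `WindowModP`),
  `‖Σ_{j∈I_B} B_j κ_j‖_p ≤ 1` (`padicNorm_gap_le_one`) and with part I
  `‖sgn·p̂_n − U/2‖_p ≤ 1` (`padicNorm_signT_formPT_sub_half_U_le_one`).
-/

noncomputable section

namespace Summit.KontsevichZagierPeriods.Zeta5Search.Denom.TwoTaleP15Window

open Finset Polynomial
open Literature.NumberTheory.Irrationality.Zudilin2014
open Summit.KontsevichZagierPeriods.Zeta5Search.TwoTaleP15
open Summit.KontsevichZagierPeriods.Zeta5Search.Denom.WindowModP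
open Summit.KontsevichZagierPeriods.Zeta5Search.Denom.WindowHarmonic

variable {n : ℕ} {p : ℕ} [hp : Fact p.Prime] {h : ℕ}

/-- `‖2‖_p = 1` for odd `p` (file-local copy; the public statement is the tree's
`SecondOrder.padicNorm_two` — kept private here to avoid a `dedup.landed` twin; lane edit lead/lit g13). -/
private theorem padicNorm_two_eq_one (h2 : p ≠ 2) : padicNorm p (2 : ℚ) = 1 := by
  simpa using padicNorm.padicNorm_of_prime_of_ne (p := p) (q := 2) h2

/-! ### `R̂` at the integer non-poles `−c`, `c ≤ 13n` -/

omit hp in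
/-- `numT` vanishes at `t = −c` when `2c` lies in the doubled zero block `[b̂₀, â₀)`. -/
theorem eval_numT_neg_int_eq_zero {a b : Fin 4 → ℤ} {c : ℤ} (hc : 2 * c ∈ Ico (b 0) (a 0)) :
    (numT a b).eval (-(c : ℚ)) = 0 := by
  unfold numT
  rw [eval_mul, eval_C, eval_mul, eval_block2, prod_eq_zero hc (by push_cast; ring), zero_mul, mul_zero]

omit hp in
/-- `R̂(−c) = 0` for `15n+2 ≤ 2c ≤ 32n+1` (P15's partner). -/
theorem RT_neg_int_eq_zero {c : ℤ} (h1 : 15 * (n : ℤ) + 2 ≤ 2 * c) (h2 : 2 * c ≤ 32 * (n : ℤ) + 1) :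
    RT (aT n) (bT n) (-(c : ℚ)) = 0 := by
  unfold RT
  rw [eval_numT_neg_int_eq_zero (by simp [mem_Ico]; omega), zero_div]

omit hp in
/-- `−c` is not a pole of `R̂` for `c ≤ 13n`. -/
theorem eval_denT_neg_int_ne_zero {c : ℤ} (hc : c ≤ 13 * (n : ℤ)) :
    (denT (aT n) (bT n)).eval (-(c : ℚ)) ≠ 0 := by
  unfold denT
  rw [eval_mul]
  refine mul_ne_zero (eval_block_ne_zero fun i hi e => ?_) (eval_block_ne_zero fun i hi e => ?_)
  · simp only [mem_Ico, aT_two, bT_two] at hi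
    have : (c : ℚ) = i := neg_injective e
    have : c = i := by exact_mod_cast this
    omega
  · simp only [mem_Ico, aT_three, bT_three] at hi
    have : (c : ℚ) = i := neg_injective e
    have : c = i := by exact_mod_cast this
    omega

/-- The polar identity at the non-pole `−c` (`15n+2 ≤ 2c`, `c ≤ 13n`):
`Σ_{j∈I_B} B_j/(j − c) = −Σ_{j∈I_A} A_j/(j − c)²`. -/
theorem sum_coefBT_div_eq (hn : 1 ≤ n) {c : ℤ} (h1 : 15 * (n : ℤ) + 2 ≤ 2 * c) (hc : c ≤ 13 * (n : ℤ)) :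
    ∑ j ∈ Ico (13 * (n : ℤ) + 1) (26 * (n : ℤ) + 2), coefBT (aT n) (bT n) j * (1 / ((j : ℚ) - c))
      = -∑ j ∈ Ico (15 * (n : ℤ) + 1) (24 * (n : ℤ) + 2), coefAT (aT n) (bT n) j / ((j : ℚ) - c) ^ 2 := by
  obtain ⟨hA3, hB2⟩ := range_eq n
  obtain ⟨hMid, hMax, -⟩ := rangeB_eq n
  have hPF := RT_eq_polar (admissibleT hn) (eval_denT_neg_int_ne_zero (n := n) hc)
  rw [hA3, hB2, hMid, hMax, RT_neg_int_eq_zero h1 (by omega)] at hPF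
  have eA : ∑ j ∈ Ico (15 * (n : ℤ) + 1) (24 * (n : ℤ) + 2), coefAT (aT n) (bT n) j / ((j : ℚ) - c) ^ 2
      = ∑ j ∈ Ico (15 * (n : ℤ) + 1) (24 * (n : ℤ) + 2), coefAT (aT n) (bT n) j / (-(c : ℚ) + j) ^ 2 :=
    sum_congr rfl fun j _ => by rw [show -(c : ℚ) + j = (j : ℚ) - c by ring]
  have eB : ∑ j ∈ Ico (13 * (n : ℤ) + 1) (26 * (n : ℤ) + 2), coefBT (aT n) (bT n) j * (1 / ((j : ℚ) - c))
      = ∑ j ∈ Ico (13 * (n : ℤ) + 1) (26 * (n : ℤ) + 2), coefBT (aT n) (bT n) j / (-(c : ℚ) + j) :=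
    sum_congr rfl fun j _ => by rw [mul_one_div, show -(c : ℚ) + j = (j : ℚ) - c by ring]
  rw [eA, eB]; linarith

/-- The `A`-part at a gap point is `p`-integral: `‖Σ_{j∈I_A} A_j/(j − c)²‖_p ≤ 1` when
`0 < j − c < p` on `I_A` (here: `26n + 2 − p ≤ c ≤ 13n`). -/
theorem padicNorm_sum_coefAT_div_sq_le_one (hn : 1 ≤ n) {c : ℤ} (hc0 : 26 * (n : ℤ) + 2 - p ≤ c)
    (hc : c ≤ 13 * (n : ℤ)) :
    padicNorm p (∑ j ∈ Ico (15 * (n : ℤ) + 1) (24 * (n : ℤ) + 2),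
      coefAT (aT n) (bT n) j / ((j : ℚ) - c) ^ 2) ≤ 1 := by
  refine padicNorm.sum_le' (fun j hj => ?_) zero_le_one
  rw [mem_Ico] at hj
  have hu : padicNorm p ((j : ℚ) - c) = 1 := by
    have := (padicNorm.int_eq_one_iff (p := p) (j - c)).2 (not_dvd_of_natAbs_lt (by omega) (by omega))
    push_cast at this; exact this
  rw [padicNorm.div, sq, padicNorm.mul, hu, mul_one, div_one]
  exact padicNorm_coefAT_le_one' hn (by omega) (by omega)

/-! ### `κ_j` modulo `p` and the gap sum -/

/-- `κ_j ≡ −Σ_{c = 26n+2−p}^{13n} 1/(j − c) (mod p)` for `j ∈ I_B` (`p = 2h+1 > 13n`). -/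
theorem kap_modP (hph : p = 2 * h + 1) (hp13 : 13 * n < p) {j : ℤ}
    (hj1 : 13 * (n : ℤ) + 1 ≤ j) (hj2 : j ≤ 26 * (n : ℤ) + 1) :
    EqModP p (kap n j) (-∑ c ∈ Ico (26 * (n : ℤ) + 2 - p) (13 * (n : ℤ) + 1), 1 / ((j : ℚ) - c)) := by
  have hr := HI_reflect_modP hph (r := (26 * (n : ℤ) + 1 - j).toNat) (by omega)
  have e1 : (((26 * (n : ℤ) + 1 - j).toNat : ℕ) : ℤ) = 26 * (n : ℤ) + 1 - j := Int.toNat_of_nonneg (by omega)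
  rw [e1] at hr
  have e2 : 2 * (h : ℤ) - (26 * (n : ℤ) + 1 - j) = j - (26 * (n : ℤ) + 2 - p) := by rw [hph]; push_cast; ring
  rw [e2] at hr
  -- `κ_j = H(j − 13n − 1) − H(26n+1−j) ≡ H(j − 13n − 1) − H(j − c₀)`
  have h1 : EqModP p (kap n j) (HI (j - (13 * (n : ℤ) + 1)) - HI (j - (26 * (n : ℤ) + 2 - p))) :=
    (EqModP.refl _).sub hr.symm
  refine h1.congr rfl ?_
  exact HI_sub_eq_neg_sum' (by omega) (by omega)

/-- **(G) The gap sum is `p`-integral**: `‖Σ_{j∈I_B} B_j κ_j‖_p ≤ 1` for `n ≥ 1`, `p = 2h+1`,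
`13n < p ≤ 17n`. -/
theorem padicNorm_gap_le_one (hn : 1 ≤ n) (hph : p = 2 * h + 1) (hp13 : 13 * n < p) (hp17 : p ≤ 17 * n) :
    padicNorm p (∑ j ∈ Ico (13 * (n : ℤ) + 1) (26 * (n : ℤ) + 2), coefBT (aT n) (bT n) j * kap n j) ≤ 1 := by
  have hK := padicNorm_sum_mul_sub_le_one (p := p) (s := Ico (13 * (n : ℤ) + 1) (26 * (n : ℤ) + 2))
    (B := fun j => coefBT (aT n) (bT n) j) (w := fun j => kap n j)
    (w' := fun j => -∑ c ∈ Ico (26 * (n : ℤ) + 2 - p) (13 * (n : ℤ) + 1), 1 / ((j : ℚ) - c))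
    (fun j hj => by rw [mem_Ico] at hj; exact padicNorm_coefBT_le_p hn hp13 hj.1 (by omega))
    (fun j hj => by rw [mem_Ico] at hj; exact kap_modP hph hp13 hj.1 (by omega))
  -- the exchanged sum: swap and evaluate by the polar identity at each gap point
  have hswap : ∑ j ∈ Ico (13 * (n : ℤ) + 1) (26 * (n : ℤ) + 2), coefBT (aT n) (bT n) j
        * (-∑ c ∈ Ico (26 * (n : ℤ) + 2 - p) (13 * (n : ℤ) + 1), 1 / ((j : ℚ) - c))
      = ∑ c ∈ Ico (26 * (n : ℤ) + 2 - p) (13 * (n : ℤ) + 1),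
          ∑ j ∈ Ico (15 * (n : ℤ) + 1) (24 * (n : ℤ) + 2), coefAT (aT n) (bT n) j / ((j : ℚ) - c) ^ 2 := by
    have e : ∀ j : ℤ, coefBT (aT n) (bT n) j
        * (-∑ c ∈ Ico (26 * (n : ℤ) + 2 - p) (13 * (n : ℤ) + 1), 1 / ((j : ℚ) - c))
        = ∑ c ∈ Ico (26 * (n : ℤ) + 2 - p) (13 * (n : ℤ) + 1),
            -(coefBT (aT n) (bT n) j * (1 / ((j : ℚ) - c))) := fun j => by
      rw [mul_neg, mul_sum, ← sum_neg_distrib]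
    simp_rw [e]
    rw [sum_comm]
    refine sum_congr rfl fun c hc => ?_
    rw [mem_Ico] at hc
    rw [sum_neg_distrib, sum_coefBT_div_eq hn (by omega) (by omega), neg_neg]
  rw [hswap] at hK
  have hI : padicNorm p (∑ c ∈ Ico (26 * (n : ℤ) + 2 - p) (13 * (n : ℤ) + 1),
      ∑ j ∈ Ico (15 * (n : ℤ) + 1) (24 * (n : ℤ) + 2), coefAT (aT n) (bT n) j / ((j : ℚ) - c) ^ 2) ≤ 1 := by
    refine padicNorm.sum_le' (fun c hc => ?_) zero_le_one
    rw [mem_Ico] at hc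
    exact padicNorm_sum_coefAT_div_sq_le_one hn hc.1 (by omega)
  have e : ∑ j ∈ Ico (13 * (n : ℤ) + 1) (26 * (n : ℤ) + 2), coefBT (aT n) (bT n) j * kap n j
      = (∑ j ∈ Ico (13 * (n : ℤ) + 1) (26 * (n : ℤ) + 2), coefBT (aT n) (bT n) j * kap n j
          - ∑ c ∈ Ico (26 * (n : ℤ) + 2 - p) (13 * (n : ℤ) + 1),
              ∑ j ∈ Ico (15 * (n : ℤ) + 1) (24 * (n : ℤ) + 2), coefAT (aT n) (bT n) j / ((j : ℚ) - c) ^ 2)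
        + ∑ c ∈ Ico (26 * (n : ℤ) + 2 - p) (13 * (n : ℤ) + 1),
            ∑ j ∈ Ico (15 * (n : ℤ) + 1) (24 * (n : ℤ) + 2), coefAT (aT n) (bT n) j / ((j : ℚ) - c) ^ 2 := by
    ring
  rw [e]
  exact padicNorm.nonarchimedean.trans (max_le hK hI)

/-- **(E)+(W)+(V)+(X)+(G)**: `‖sgn·p̂_n − U/2‖_p ≤ 1` for `n ≥ 1`, `p = 2h+1`, `13n < p ≤ 17n`. -/
theorem padicNorm_signT_formPT_sub_half_U_le_one (hn : 1 ≤ n) (hph : p = 2 * h + 1) (hp13 : 13 * n < p)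
    (hp17 : p ≤ 17 * n) :
    padicNorm p (signT (bT n) * formPT (aT n) (bT n) - Utop n p h / 2) ≤ 1 := by
  have h2 : p ≠ 2 := by omega
  have hX := padicNorm_window_weights_le_one hn hph hp13 (by omega)
  have hG := padicNorm_gap_le_one hn hph hp13 hp17
  have hG2 : padicNorm p ((∑ j ∈ Ico (13 * (n : ℤ) + 1) (26 * (n : ℤ) + 2),
      coefBT (aT n) (bT n) j * kap n j) / 2) ≤ 1 := by
    rw [padicNorm.div, padicNorm_two_eq_one h2, div_one]; exact hG
  have e : signT (bT n) * formPT (aT n) (bT n) - Utop n p h / 2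
      = (signT (bT n) * formPT (aT n) (bT n) - Utop n p h / 2
          + (∑ j ∈ Ico (13 * (n : ℤ) + 1) (26 * (n : ℤ) + 2), coefBT (aT n) (bT n) j * kap n j) / 2)
        - (∑ j ∈ Ico (13 * (n : ℤ) + 1) (26 * (n : ℤ) + 2), coefBT (aT n) (bT n) j * kap n j) / 2 := by
    ring
  rw [e]
  exact padicNorm.sub.trans (max_le hX hG2)

end Summit.KontsevichZagierPeriods.Zeta5Search.Denom.TwoTaleP15Window

end
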